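import Literature.Analysis.FunctionSpaces.TorusFluidGlueProofs
import Literature.Analysis.FunctionSpaces.TorusCalculusProofs
import HarnessLib

/-!
# Bad sequences do asymptotically zero work (tools lemma for `stub_f123NoOnsagerDodger`,
# crux stmt-AnomalousDissipation-13038, line `lamb-floor-f123-shared-ceiling`)

The floor stub `stub_f123NoOnsagerDodger` of the line quantifies over BAD SEQUENCES of a force `f`:
admissible (smooth, divergence-free, mean-zero) fields `u_n` with dual residual bounds
`|∫⟪(u_n·∇)u_n − f, w⟫| ≤ R_n √(gradNormSq w)` for every admissible test `w`, and vanishing VIRTUAL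
DISSIPATION `R_n √(gradNormSq u_n) → 0`.  This file records the first structural consequence of these
hypotheses, valid for every smooth `f` and with no energy bound:

* `abs_work_le_of_residualBound` — testing the residual bound with `w = u` itself and using
  `∫⟪(u·∇)u, u⟫ = 0` (`Torus.integral_inner_convect_self_eq_zero`) gives `|∫⟪f, u⟫| ≤ R √(gradNormSq u)`;
* `stub_badSeqZeroWork` (registered tools stub) — hence along a bad sequence the WORK of the force
  tends to zero: `∫⟪f, u_n⟫ → 0`.

Consequences used in the line's notes (`Lines/lamb-floor-f123-shared-ceiling-S1-dodgers.md`, lead notes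
`S1-c1-analysis.md` §P1): every strong `L²` limit of a bad sequence is a standing flow of `f` doing ZERO work
(a quiet point), and at a steady state of `NS_ν(f)` (where `R = ν‖∇u‖`, `R‖∇u‖ = ν‖∇u‖² = (f,u)`) the lemma
is the energy identity read backwards.  Elementary; [folklore].
-/

noncomputable section

-- `Summit.<Summit>.<Problem>` is the tree's mandated summit-side namespace (CONVENTIONS §2); single-conjunct summit, duplicate deliberate.
set_option linter.dupNamespace false

open MeasureTheory Filter Topology

namespace Summit.AnomalousDissipation.AnomalousDissipation.Theorems.SteadyStatesLoudBounded.BadSeqZeroWork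

open Literature.Analysis.FunctionSpaces
open scoped InnerProductSpace

/-- **Work bound from the residual bound tested on the field itself.** For smooth `f`, smooth
divergence-free `u` and `|∫⟪(u·∇)u − f, u⟫| ≤ R √(gradNormSq u)`: `|∫⟪f, u⟫| ≤ R √(gradNormSq u)`
(because `∫⟪(u·∇)u, u⟫ = 0`). -/
theorem abs_work_le_of_residualBound {f u : UnitAddTorus (Fin 3) → EuclideanSpace ℝ (Fin 3)}
    (hf : Torus.IsSmooth f) (hu : Torus.IsSmooth u) (hud : Torus.IsDivFree u) {R : ℝ}
    (hres : |∫ x, ⟪Torus.convect u u x - f x, u x⟫_ℝ| ≤ R * Real.sqrt (Torus.gradNormSq u)) :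
    |∫ x, ⟪f x, u x⟫_ℝ| ≤ R * Real.sqrt (Torus.gradNormSq u) := by
  have i1 : Integrable (fun x => ⟪Torus.convect u u x, u x⟫_ℝ) volume :=
    ((hu.convect hu).inner hu).integrable
  have i2 : Integrable (fun x => ⟪f x, u x⟫_ℝ) volume := (hf.inner hu).integrable
  have hsplit : ∫ x, ⟪Torus.convect u u x - f x, u x⟫_ℝ =
      (∫ x, ⟪Torus.convect u u x, u x⟫_ℝ) - ∫ x, ⟪f x, u x⟫_ℝ := by
    rw [← integral_sub i1 i2]
    exact integral_congr_ae (ae_of_all _ fun x => inner_sub_left _ _ _)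
  rw [hsplit, Torus.integral_inner_convect_self_eq_zero hu hud, zero_sub, abs_neg] at hres
  exact hres

/-- **Registered tools stub `stub_badSeqZeroWork`: bad sequences do asymptotically zero work.** For a
smooth force `f` and admissible fields `u_n` (smooth, divergence-free, mean-zero) obeying the dual residual
bounds `|∫⟪(u_n·∇)u_n − f, w⟫| ≤ R_n √(gradNormSq w)` against every admissible test field `w`, vanishing
virtual dissipation `R_n √(gradNormSq u_n) → 0` forces `∫⟪f, u_n⟫ → 0`. (Test with `w = u_n`.) -/
theorem stub_badSeqZeroWork : ∀ (f : UnitAddTorus (Fin 3) → EuclideanSpace ℝ (Fin 3)) (u : ℕ → UnitAddTorus (Fin 3) → EuclideanSpace ℝ (Fin 3)) (R : ℕ → ℝ), Torus.IsSmooth f → (∀ n : ℕ, Torus.IsSmooth (u n) ∧ Torus.IsDivFree (u n) ∧ Torus.HasZeroMean (u n) ∧ ∀ w : UnitAddTorus (Fin 3) → EuclideanSpace ℝ (Fin 3), Torus.IsSmooth w → Torus.IsDivFree w → Torus.HasZeroMean w → |∫ x, inner ℝ (Torus.convect (u n) (u n) x - f x) (w x)| ≤ R n * Real.sqrt (Torus.gradNormSq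 w)) → Filter.Tendsto (fun n => R n * Real.sqrt (Torus.gradNormSq (u n))) Filter.atTop (nhds 0) → Filter.Tendsto (fun n => ∫ x, inner ℝ (f x) (u n x)) Filter.atTop (nhds 0) := by
  intro f u R hf hseq hRD
  refine squeeze_zero_norm (fun n => ?_) hRD
  obtain ⟨hus, hud, huz, hres⟩ := hseq n
  rw [Real.norm_eq_abs]
  exact abs_work_le_of_residualBound hf hus hud (hres (u n) hus hud huz)

end Summit.AnomalousDissipation.AnomalousDissipation.Theorems.SteadyStatesLoudBounded.BadSeqZeroWork

end
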